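import Summits.Parity.GeneralizedHardyLittlewood.Theorems.BeyondDiagonalBeatsQuarter.OffDiagCoreLevelsTruncCount
import HarnessLib

/-!
# Route `PrimeLevelFamEdge`, crux K_B (stmt-Parity-20343), line `diagonal_kernel_split` rev 4, plan Ω,
# node **L7d part 2, leaf W (D5a‴) — the level-DEPENDENT `s`-window of the level-innermost core, and its funded tail**
# (L7D-PLAN rev 5 §5 (1); companion of `OffDiagCoreLevelsTrunc` / `…TruncCount`)

`OffDiagCoreLevelsTrunc` truncated the `s`-series of a switched piece at a level-FREE height `Sf(cell,h₁)`; for the large sieve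
of D5b the family member `x = (cell, h₁, s)` must instead be ACTIVE only at the levels `q` with
`|s + ab/(q(r+1))| ≤ T(cell,h₁)` (its window — an interval in `q`), because the dual transform is negligible exactly off this
window and a pointwise-in-`τ` large sieve cannot see that. This file performs the level-dependent truncation:

* `coreWin W T G Q N Hf Δ′` — the windowed (finite) family: the nest at the block top `Q`, `h₁ ∈ [−H*, H*]`,
  `s ∈ [−Sf, Sf]` with `Sf = T + ⌈|ab/(N(r+1))|⌉₊`, and INSIDE the level sum the window indicator
  `𝟙[¬ (T < |s + ab/(q(r+1))|)]`; `coreTailW W T G Q Hf Δ′` — the complement (an `s`-series);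
* **`coreWithW_eq_win_add_tailW`** — `coreWithW W G Hf Δ′ = coreWin + coreTailW` for levels `2 ≤ q ≤ Q`, `N ≤ q` on `G`
  (`tsum_window_split`: outside `[−Sf, Sf]` no level is in the window, `lt_abs_add_of_lt_abs`);
* **`abs_coreTailW_le`** — the window tail has the SAME majorant as `abs_coreTailS_le` (shifted-lattice tails at height `T`);
* **`coreTailW_funded`** — hence, with `T = tailHeight ε₀ N` and the count of `OffDiagCoreLevelsTruncCount`, for `0 < ε₀ ≤ 1`,
  every `Δ′ ∈ (1,2)`, `ε > 0`, eventually in `N` and uniformly in `‖W‖ ≤ 1`: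
  `|coreTailW W (tailHeight ε₀ N) (goodPrimes Δ′ N) (2N) (coreHeight ε₀) Δ′| ≤ ε·Σ_{q ∈ goodPrimes Δ′ N} ms(q)`.

Rearrangement of absolutely convergent series plus the D5a′ count; standard axioms. Helper toward `stub_offDiagBelowSlack_io`;
closes nothing. «The programme SEARCHES and TYPES; no claim about Landau–Siegel zeros, Theorems 1–2 of arXiv:2211.02515 or
a repaired Margin232 until a kernel theorem says so.»
-/

noncomputable section

open Finset Real Polynomial
open scoped Nat

namespace Summit.Parity.GeneralizedHardyLittlewood.Theorems.BeyondDiagonalBeatsQuarter.OffDiag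

open Literature.NumberTheory.LFunctions Literature.NumberTheory.LFunctions.KMV2000
open Literature.NumberTheory.Sieve.FriedlanderIwaniecPrimes (fourier2)
open Literature.Analysis.Calculus.WhitneyConvex (dyadicBumpBound dyadicBumpBound_nonneg)
open PeterssonSplit (nearBoxes two_pi_mul_qhat_sq qhat_sq_le)

/-! ### §1. Splitting an `s`-series along a level-dependent window -/

/-- **Window split of an `s`-series of level sums.** For levels `G`, summands `g s q` summable in `s` for each `q ∈ G`, a
decidable window `win q s` and `S` with `win q s → |s| ≤ S` on `G`:
`Σ'_s Σ_{q∈G} g s q = Σ_{s∈[−S,S]} Σ_{q∈G} 𝟙[win q s]·g s q + Σ'_s Σ_{q∈G} 𝟙[¬win q s]·g s q`. [folklore] -/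
theorem tsum_window_split {g : ℤ → ℕ → ℂ} {G : Finset ℕ} (hg : ∀ q ∈ G, Summable fun s : ℤ ↦ g s q)
    (win : ℕ → ℤ → Prop) [∀ q s, Decidable (win q s)] {S : ℕ} (hS : ∀ q ∈ G, ∀ s : ℤ, win q s → |s| ≤ (S : ℤ)) :
    ∑' s : ℤ, ∑ q ∈ G, g s q =
      ∑ s ∈ Icc (-(S : ℤ)) S, ∑ q ∈ G, (if win q s then g s q else 0) +
        ∑' s : ℤ, ∑ q ∈ G, (if win q s then 0 else g s q) := by
  have hsplit : ∀ s : ℤ, ∑ q ∈ G, g s q =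
      ∑ q ∈ G, (if win q s then g s q else 0) + ∑ q ∈ G, (if win q s then 0 else g s q) := by
    intro s
    rw [← Finset.sum_add_distrib]
    exact Finset.sum_congr rfl fun q _ ↦ by split_ifs <;> simp
  have h1 : ∀ q ∈ G, Summable fun s : ℤ ↦ (if win q s then g s q else 0) := by
    intro q hq
    refine ((hg q hq).indicator {s : ℤ | win q s}).congr fun s ↦ ?_
    simp only [Set.indicator_apply, Set.mem_setOf_eq]
  have h2 : ∀ q ∈ G, Summable fun s : ℤ ↦ (if win q s then 0 else g s q) := by
    intro q hq
    refine ((hg q hq).indicator {s : ℤ | ¬ win q s}).congr fun s ↦ ?_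
    simp only [Set.indicator_apply, Set.mem_setOf_eq]
    split_ifs <;> simp_all
  rw [tsum_congr hsplit, (summable_sum h1).tsum_add (summable_sum h2)]
  congr 1
  rw [tsum_eq_sum (s := Icc (-(S : ℤ)) S)]
  intro s hs
  refine Finset.sum_eq_zero fun q hq ↦ ?_
  rw [if_neg]
  intro hw
  exact hs (Finset.mem_Icc.mpr (abs_le.mp (hS q hq s hw)))

/-! ### §2. The windowed family and the window tail -/

open Classical in
/-- **The windowed (finite) family of a switched piece** at the block top `Q`, reference level `N` and window height `T`:
the cell nest, `h₁ ∈ [−H*, H*]`, `s ∈ [−Sf, Sf]` (`Sf = T + ⌈|ab/(N(r+1))|⌉₊`), and inside the level sum the window indicator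
`𝟙[¬ (T < |s + ab/(q(r+1))|)]` — member `(cell,h₁,s)` is active only at the levels of its window.
[cite: KowalskiMichelVanderKam2000, §6 p. 19, (21)–(23) p. 12 — derivation] -/
def coreWin (W : ℕ → ℕ → ℕ → ℕ → ℕ → ℕ → ℕ × ℕ → ℤ → ℤ → ℂ) (T : ℕ → ℕ → ℕ → ℕ → ℕ → ℕ × ℕ → ℤ → ℕ)
    (G : Finset ℕ) (Q N : ℕ) (Hf : ℕ → ℕ → ℕ → ℕ → ℕ → ℕ → ℕ × ℕ → ℕ) (Δ' : ℝ) : ℝ :=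
  -((∑ r ∈ Finset.range (Q ^ 7), ∑ l ∈ Finset.Icc 1 ⌊qhat Q ^ Δ'⌋₊, ∑ m ∈ Finset.Icc 1 ⌊qhat Q ^ Δ'⌋₊,
      ∑ d₁ ∈ l.divisors, ∑ d₂ ∈ m.divisors, ∑ i ∈ nearBoxes Q d₁ d₂ (Real.log Q ^ 4),
        if Nat.Coprime (l / d₁) (r + 1) then
          ∑ h₁ ∈ Icc (-((G.sup (fun q ↦ Hf q d₁ d₂ (l / d₁) (m / d₂) (r + 1) i) : ℕ) : ℤ))
              ((G.sup (fun q ↦ Hf q d₁ d₂ (l / d₁) (m / d₂) (r + 1) i) : ℕ) : ℤ),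
            ∑ s ∈ Icc (-((T r l m d₁ d₂ i h₁ +
                  ⌈|((((l / d₁ : ℕ) : ℤ) * (m / d₂ : ℕ) : ℤ) : ℝ) / ((N : ℝ) * ((r + 1 : ℕ) : ℝ))|⌉₊ : ℕ) : ℤ))
                ((T r l m d₁ d₂ i h₁ +
                  ⌈|((((l / d₁ : ℕ) : ℤ) * (m / d₂ : ℕ) : ℤ) : ℝ) / ((N : ℝ) * ((r + 1 : ℕ) : ℝ))|⌉₊ : ℕ) : ℤ),
              ∑ q ∈ G, (if (T r l m d₁ d₂ i h₁ : ℝ) <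
                  |(s : ℝ) + ((((l / d₁ : ℕ) : ℤ) * (m / d₂ : ℕ) : ℤ) : ℝ) / ((q * (r + 1) : ℕ) : ℝ)| then 0 else
                levelSummand (fun q ↦ if r < q ^ 7 ∧ l ≤ ⌊qhat q ^ Δ'⌋₊ ∧ m ≤ ⌊qhat q ^ Δ'⌋₊ ∧
                      i ∈ nearBoxes q d₁ d₂ (Real.log q ^ 4) then
                    2 * (qhat q : ℂ) * (2 * π / q) *
                      (((mollifierCoeff (X ^ 2) (qhat q ^ Δ') l * mollifierCoeff (X ^ 2) (qhat q ^ Δ') m : ℝ) : ℂ))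
                  else 0) W Hf r l m d₁ d₂ i h₁ s q)
        else 0).re)

open Classical in
/-- **The window tail of a switched piece**: the same nest with the `s`-series of the level summands OFF the window,
`𝟙[T < |s + ab/(q(r+1))|]`. [cite: KowalskiMichelVanderKam2000, §6 p. 19 — derivation] -/
def coreTailW (W : ℕ → ℕ → ℕ → ℕ → ℕ → ℕ → ℕ × ℕ → ℤ → ℤ → ℂ) (T : ℕ → ℕ → ℕ → ℕ → ℕ → ℕ × ℕ → ℤ → ℕ)
    (G : Finset ℕ) (Q : ℕ) (Hf : ℕ → ℕ → ℕ → ℕ → ℕ → ℕ → ℕ × ℕ → ℕ) (Δ' : ℝ) : ℝ :=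
  -((∑ r ∈ Finset.range (Q ^ 7), ∑ l ∈ Finset.Icc 1 ⌊qhat Q ^ Δ'⌋₊, ∑ m ∈ Finset.Icc 1 ⌊qhat Q ^ Δ'⌋₊,
      ∑ d₁ ∈ l.divisors, ∑ d₂ ∈ m.divisors, ∑ i ∈ nearBoxes Q d₁ d₂ (Real.log Q ^ 4),
        if Nat.Coprime (l / d₁) (r + 1) then
          ∑ h₁ ∈ Icc (-((G.sup (fun q ↦ Hf q d₁ d₂ (l / d₁) (m / d₂) (r + 1) i) : ℕ) : ℤ))
              ((G.sup (fun q ↦ Hf q d₁ d₂ (l / d₁) (m / d₂) (r + 1) i) : ℕ) : ℤ),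
            ∑' s : ℤ, ∑ q ∈ G, (if (T r l m d₁ d₂ i h₁ : ℝ) <
                  |(s : ℝ) + ((((l / d₁ : ℕ) : ℤ) * (m / d₂ : ℕ) : ℤ) : ℝ) / ((q * (r + 1) : ℕ) : ℝ)| then
                levelSummand (fun q ↦ if r < q ^ 7 ∧ l ≤ ⌊qhat q ^ Δ'⌋₊ ∧ m ≤ ⌊qhat q ^ Δ'⌋₊ ∧
                      i ∈ nearBoxes q d₁ d₂ (Real.log q ^ 4) then
                    2 * (qhat q : ℂ) * (2 * π / q) *
                      (((mollifierCoeff (X ^ 2) (qhat q ^ Δ') l * mollifierCoeff (X ^ 2) (qhat q ^ Δ') m : ℝ) : ℂ))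
                  else 0) W Hf r l m d₁ d₂ i h₁ s q else 0)
        else 0).re)

open Classical in
/-- **A switched piece is its windowed family plus its window tail.** For levels `G` with `2 ≤ q ≤ Q` and `N ≤ q`
(`N ≥ 1`), `Δ′ ≥ 0` and a bounded weight: `coreWithW W G Hf Δ′ = coreWin W T G Q N Hf Δ′ + coreTailW W T G Q Hf Δ′`.
[folklore] -/
theorem coreWithW_eq_win_add_tailW {W : ℕ → ℕ → ℕ → ℕ → ℕ → ℕ → ℕ × ℕ → ℤ → ℤ → ℂ} {B : ℝ}
    (hW : ∀ q r l m d₁ d₂ i h₁ s, ‖W q r l m d₁ d₂ i h₁ s‖ ≤ B)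
    (T : ℕ → ℕ → ℕ → ℕ → ℕ → ℕ × ℕ → ℤ → ℕ) (G : Finset ℕ) {Q N : ℕ} (hN : 1 ≤ N)
    (hG : ∀ q ∈ G, 2 ≤ q ∧ q ≤ Q ∧ N ≤ q) (Hf : ℕ → ℕ → ℕ → ℕ → ℕ → ℕ → ℕ × ℕ → ℕ) {Δ' : ℝ} (hΔ : 0 ≤ Δ') :
    coreWithW W G Hf Δ' = coreWin W T G Q N Hf Δ' + coreTailW W T G Q Hf Δ' := by
  have hG' : ∀ q ∈ G, 2 ≤ q ∧ q ≤ Q := fun q hq ↦ ⟨(hG q hq).1, (hG q hq).2.1⟩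
  rw [coreWithW_eq_levels hW G hG' Hf hΔ, coreWin, coreTailW, ← neg_re_add, ← Finset.sum_add_distrib]
  refine neg_re_congr (Finset.sum_congr rfl fun r _ ↦ ?_)
  rw [← Finset.sum_add_distrib]
  refine Finset.sum_congr rfl fun l _ ↦ ?_
  rw [← Finset.sum_add_distrib]
  refine Finset.sum_congr rfl fun m _ ↦ ?_
  rw [← Finset.sum_add_distrib]
  refine Finset.sum_congr rfl fun d₁ _ ↦ ?_
  rw [← Finset.sum_add_distrib]
  refine Finset.sum_congr rfl fun d₂ _ ↦ ?_
  rw [← Finset.sum_add_distrib]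
  refine Finset.sum_congr rfl fun i _ ↦ ?_
  split_ifs with hcop
  · rw [← Finset.sum_add_distrib]
    refine Finset.sum_congr rfl fun h₁ _ ↦ ?_
    have hwin := tsum_window_split (G := G)
      (g := fun s q ↦ levelSummand (fun q ↦ if r < q ^ 7 ∧ l ≤ ⌊qhat q ^ Δ'⌋₊ ∧ m ≤ ⌊qhat q ^ Δ'⌋₊ ∧
            i ∈ nearBoxes q d₁ d₂ (Real.log q ^ 4) then
          2 * (qhat q : ℂ) * (2 * π / q) *
            (((mollifierCoeff (X ^ 2) (qhat q ^ Δ') l * mollifierCoeff (X ^ 2) (qhat q ^ Δ') m : ℝ) : ℂ))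
        else 0) W Hf r l m d₁ d₂ i h₁ s q)
      (fun q hq ↦ summable_levelSummand (fun q ↦ if r < q ^ 7 ∧ l ≤ ⌊qhat q ^ Δ'⌋₊ ∧ m ≤ ⌊qhat q ^ Δ'⌋₊ ∧
            i ∈ nearBoxes q d₁ d₂ (Real.log q ^ 4) then
          2 * (qhat q : ℂ) * (2 * π / q) *
            (((mollifierCoeff (X ^ 2) (qhat q ^ Δ') l * mollifierCoeff (X ^ 2) (qhat q ^ Δ') m : ℝ) : ℂ))
        else 0) hW Hf (hG q hq).1 r l m d₁ d₂ i h₁)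
      (fun q s ↦ ¬ ((T r l m d₁ d₂ i h₁ : ℝ) <
        |(s : ℝ) + ((((l / d₁ : ℕ) : ℤ) * (m / d₂ : ℕ) : ℤ) : ℝ) / ((q * (r + 1) : ℕ) : ℝ)|))
      (S := T r l m d₁ d₂ i h₁ + ⌈|((((l / d₁ : ℕ) : ℤ) * (m / d₂ : ℕ) : ℤ) : ℝ) / ((N : ℝ) * ((r + 1 : ℕ) : ℝ))|⌉₊)
      (fun q hq s hw ↦ by
        by_contra hlt
        exact hw (lt_abs_add_of_lt_abs (lt_of_le_of_lt (by
          exact_mod_cast Nat.add_le_add_left (Nat.ceil_mono (abs_shift_le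
            (A := ((l / d₁ : ℕ) : ℤ) * (m / d₂ : ℕ)) (r := r) hN (hG q hq).2.2)) (T r l m d₁ d₂ i h₁))
          (not_le.mp hlt))))
    rw [hwin]
    simp only [ite_not]
  · rw [add_zero]

/-! ### §3. The window tail against the shifted-lattice tails -/

open Classical in
/-- **One cell, one modulus: the window tail of the level summands against the shifted-lattice tails.** For `‖W‖ ≤ 1`,
levels `G` with `2 ≤ q`, a scalar level factor `c` and a height `T`:
`‖Σ'_s Σ_{q∈G} 𝟙[T < |s + ab/(q(r+1))|]·levelSummand c W Hf cell h₁ s q‖ ≤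
 Σ_{q∈G} 𝟙[h₁ unit mod q(r+1)]·‖c q‖·Σ'_s 𝟙[T < |s + ab/(q(r+1))|]·‖Φ̂_q(h₁/(q(r+1)), s/h₁ + ab/(h₁q(r+1)))‖`. [folklore] -/
theorem norm_tsum_windowTail_levelSummand_le {W : ℕ → ℕ → ℕ → ℕ → ℕ → ℕ → ℕ × ℕ → ℤ → ℤ → ℂ}
    (hW : ∀ q r l m d₁ d₂ i h₁ s, ‖W q r l m d₁ d₂ i h₁ s‖ ≤ 1) (c : ℕ → ℂ)
    (G : Finset ℕ) (hG : ∀ q ∈ G, 2 ≤ q)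
    (Hf : ℕ → ℕ → ℕ → ℕ → ℕ → ℕ → ℕ × ℕ → ℕ) (r l m d₁ d₂ : ℕ) (i : ℕ × ℕ) (h₁ : ℤ) (T : ℕ) :
    ‖∑' s : ℤ, ∑ q ∈ G, (if (T : ℝ) < |(s : ℝ) + ((((l / d₁ : ℕ) : ℤ) * (m / d₂ : ℕ) : ℤ) : ℝ) / ((q * (r + 1) : ℕ) : ℝ)|
        then levelSummand c W Hf r l m d₁ d₂ i h₁ s q else 0)‖ ≤
      ∑ q ∈ G, (if IsUnit ((h₁ : ℤ) : ZMod (q * (r + 1))) then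
        ‖c q‖ * ∑' s : ℤ, (if (T : ℝ) < |(s : ℝ) + ((((l / d₁ : ℕ) : ℤ) * (m / d₂ : ℕ) : ℤ) : ℝ) / ((q * (r + 1) : ℕ) : ℝ)| then
          ‖fourier2 (boxWeight q d₁ d₂ (l / d₁) (m / d₂) (r + 1) i) (h₁ / (q * (r + 1) : ℕ))
            ((s : ℝ) / h₁ + (((l / d₁ : ℕ) : ℤ) * (m / d₂ : ℕ) : ℝ) / ((h₁ : ℝ) * (q * (r + 1) : ℕ)))‖ else 0)
        else 0) := by
  -- summability of each level's majorant term
  have hsumq : ∀ q ∈ G, Summable (fun s : ℤ ↦ (if IsUnit ((h₁ : ℤ) : ZMod (q * (r + 1))) then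
      ‖c q‖ * (if (T : ℝ) < |(s : ℝ) + ((((l / d₁ : ℕ) : ℤ) * (m / d₂ : ℕ) : ℤ) : ℝ) / ((q * (r + 1) : ℕ) : ℝ)| then
        ‖fourier2 (boxWeight q d₁ d₂ (l / d₁) (m / d₂) (r + 1) i) (h₁ / (q * (r + 1) : ℕ))
          ((s : ℝ) / h₁ + (((l / d₁ : ℕ) : ℤ) * (m / d₂ : ℕ) : ℝ) / ((h₁ : ℝ) * (q * (r + 1) : ℕ)))‖ else 0) else 0)) := by
    intro q hq
    by_cases hu : IsUnit ((h₁ : ℤ) : ZMod (q * (r + 1)))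
    swap
    · simp only [if_neg hu]; exact summable_zero
    simp only [if_pos hu]
    have hq2 := hG q hq
    have hC : 2 ≤ q * (r + 1) := le_trans hq2 (Nat.le_mul_of_pos_right q (Nat.succ_pos r))
    haveI : NeZero (q * (r + 1)) := ⟨by omega⟩
    haveI : NeZero q := ⟨by omega⟩
    have hh₁ : h₁ ≠ 0 := intCast_ne_zero_of_isUnit hC hu
    have hΦ := summable_fourier2_boxWeight_intShift q d₁ d₂ (l / d₁) (m / d₂) (r + 1) i
      ((h₁ : ℝ) / (q * (r + 1) : ℕ)) ((((l / d₁ : ℕ) : ℤ) * (m / d₂ : ℕ) : ℝ) / ((h₁ : ℝ) * (q * (r + 1) : ℕ))) hh₁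
    refine Summable.of_nonneg_of_le (fun s ↦ by positivity) (fun s ↦ ?_) (hΦ.norm.mul_left ‖c q‖)
    split_ifs
    · exact le_refl _
    · exact mul_le_mul_of_nonneg_left (norm_nonneg _) (norm_nonneg _)
  -- pointwise majorant
  have hpt : ∀ s : ℤ, ‖∑ q ∈ G, (if (T : ℝ) < |(s : ℝ) + ((((l / d₁ : ℕ) : ℤ) * (m / d₂ : ℕ) : ℤ) : ℝ) / ((q * (r + 1) : ℕ) : ℝ)|
        then levelSummand c W Hf r l m d₁ d₂ i h₁ s q else 0)‖ ≤
      ∑ q ∈ G, (if IsUnit ((h₁ : ℤ) : ZMod (q * (r + 1))) then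
        ‖c q‖ * (if (T : ℝ) < |(s : ℝ) + ((((l / d₁ : ℕ) : ℤ) * (m / d₂ : ℕ) : ℤ) : ℝ) / ((q * (r + 1) : ℕ) : ℝ)| then
          ‖fourier2 (boxWeight q d₁ d₂ (l / d₁) (m / d₂) (r + 1) i) (h₁ / (q * (r + 1) : ℕ))
            ((s : ℝ) / h₁ + (((l / d₁ : ℕ) : ℤ) * (m / d₂ : ℕ) : ℝ) / ((h₁ : ℝ) * (q * (r + 1) : ℕ)))‖ else 0) else 0) := by
    intro s
    refine norm_sum_le_of_le _ fun q hq ↦ ?_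
    by_cases hwin : (T : ℝ) < |(s : ℝ) + ((((l / d₁ : ℕ) : ℤ) * (m / d₂ : ℕ) : ℤ) : ℝ) / ((q * (r + 1) : ℕ) : ℝ)|
    swap
    · rw [if_neg hwin, norm_zero]; split_ifs <;> positivity
    rw [if_pos hwin]
    unfold levelSummand
    by_cases hH : |h₁| ≤ (Hf q d₁ d₂ (l / d₁) (m / d₂) (r + 1) i : ℤ)
    swap
    · rw [if_neg hH, norm_zero]; split_ifs <;> positivity
    rw [if_pos hH]
    by_cases hu : IsUnit ((h₁ : ℤ) : ZMod (q * (r + 1)))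
    swap
    · rw [if_neg hu, if_neg hu, norm_zero]
    rw [if_pos hu, if_pos hu, if_pos hwin]
    split_ifs with hadm
    · rw [norm_mul, norm_mul]
      refine mul_le_mul_of_nonneg_left ?_ (norm_nonneg _)
      calc ‖W q r l m d₁ d₂ i h₁ s‖ * _ ≤ 1 * _ := mul_le_mul_of_nonneg_right (hW q r l m d₁ d₂ i h₁ s) (norm_nonneg _)
        _ = _ := one_mul _
    · rw [norm_zero]; positivity
  have hGsum := summable_sum hsumq
  have hFsum := Summable.of_nonneg_of_le (fun s ↦ norm_nonneg _) hpt hGsum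
  refine (norm_tsum_le_tsum_norm hFsum).trans ((hFsum.tsum_le_tsum hpt hGsum).trans (le_of_eq ?_))
  rw [Summable.tsum_finsetSum hsumq]
  refine Finset.sum_congr rfl fun q _ ↦ ?_
  by_cases hu : IsUnit ((h₁ : ℤ) : ZMod (q * (r + 1)))
  · simp only [if_pos hu]
    rw [tsum_mul_left]
  · simp only [if_neg hu, tsum_zero]

open Classical in
/-- **The window tail is controlled by the shifted-lattice tails of the box transforms** — the SAME majorant as
`abs_coreTailS_le`: for `‖W‖ ≤ 1`, levels `2 ≤ q` on `G`, any `Δ′`, `Hf`, `Q` and height function `T(cell, h₁)`,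
`|coreTailW W T G Q Hf Δ′| ≤ Σ_{nest} 𝟙[cop]·Σ_{|h₁| ≤ H*} Σ_{q∈G} 𝟙[h₁ unit mod q(r+1)]·‖c_{cell}(q)‖·
   Σ'_s 𝟙[T < |s + ab/(q(r+1))|]·‖Φ̂_q(h₁/(q(r+1)), s/h₁ + ab/(h₁q(r+1)))‖`. [folklore] -/
theorem abs_coreTailW_le {W : ℕ → ℕ → ℕ → ℕ → ℕ → ℕ → ℕ × ℕ → ℤ → ℤ → ℂ}
    (hW : ∀ q r l m d₁ d₂ i h₁ s, ‖W q r l m d₁ d₂ i h₁ s‖ ≤ 1)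
    (T : ℕ → ℕ → ℕ → ℕ → ℕ → ℕ × ℕ → ℤ → ℕ) (G : Finset ℕ) {Q : ℕ}
    (hG : ∀ q ∈ G, 2 ≤ q) (Hf : ℕ → ℕ → ℕ → ℕ → ℕ → ℕ → ℕ × ℕ → ℕ) (Δ' : ℝ) :
    |coreTailW W T G Q Hf Δ'| ≤
      ∑ r ∈ Finset.range (Q ^ 7), ∑ l ∈ Finset.Icc 1 ⌊qhat Q ^ Δ'⌋₊, ∑ m ∈ Finset.Icc 1 ⌊qhat Q ^ Δ'⌋₊,
        ∑ d₁ ∈ l.divisors, ∑ d₂ ∈ m.divisors, ∑ i ∈ nearBoxes Q d₁ d₂ (Real.log Q ^ 4),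
          if Nat.Coprime (l / d₁) (r + 1) then
            ∑ h₁ ∈ Icc (-((G.sup (fun q ↦ Hf q d₁ d₂ (l / d₁) (m / d₂) (r + 1) i) : ℕ) : ℤ))
                ((G.sup (fun q ↦ Hf q d₁ d₂ (l / d₁) (m / d₂) (r + 1) i) : ℕ) : ℤ),
              ∑ q ∈ G, (if IsUnit ((h₁ : ℤ) : ZMod (q * (r + 1))) then
                ‖(if r < q ^ 7 ∧ l ≤ ⌊qhat q ^ Δ'⌋₊ ∧ m ≤ ⌊qhat q ^ Δ'⌋₊ ∧ i ∈ nearBoxes q d₁ d₂ (Real.log q ^ 4) then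
                    2 * (qhat q : ℂ) * (2 * π / q) *
                      (((mollifierCoeff (X ^ 2) (qhat q ^ Δ') l * mollifierCoeff (X ^ 2) (qhat q ^ Δ') m : ℝ) : ℂ))
                  else 0)‖ *
                ∑' s : ℤ, (if (T r l m d₁ d₂ i h₁ : ℝ) <
                    |(s : ℝ) + ((((l / d₁ : ℕ) : ℤ) * (m / d₂ : ℕ) : ℤ) : ℝ) / ((q * (r + 1) : ℕ) : ℝ)| then
                  ‖fourier2 (boxWeight q d₁ d₂ (l / d₁) (m / d₂) (r + 1) i) (h₁ / (q * (r + 1) : ℕ))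
                    ((s : ℝ) / h₁ + (((l / d₁ : ℕ) : ℤ) * (m / d₂ : ℕ) : ℝ) / ((h₁ : ℝ) * (q * (r + 1) : ℕ)))‖ else 0)
                else 0)
          else 0 := by
  unfold coreTailW
  rw [abs_neg]
  refine (Complex.abs_re_le_norm _).trans ?_
  refine norm_sum_le_of_le _ fun r _ ↦ norm_sum_le_of_le _ fun l _ ↦ norm_sum_le_of_le _ fun m _ ↦
    norm_sum_le_of_le _ fun d₁ _ ↦ norm_sum_le_of_le _ fun d₂ _ ↦ norm_sum_le_of_le _ fun i _ ↦ ?_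
  by_cases hcop : Nat.Coprime (l / d₁) (r + 1)
  swap
  · rw [if_neg hcop, if_neg hcop, norm_zero]
  rw [if_pos hcop, if_pos hcop]
  refine norm_sum_le_of_le _ fun h₁ _ ↦ ?_
  exact norm_tsum_windowTail_levelSummand_le hW _ G hG Hf r l m d₁ d₂ i h₁ (T r l m d₁ d₂ i h₁)

/-! ### §4. The window tail is funded -/

section Block

variable {N : ℕ}

open Classical in
/-- **The window tail at `T = tailHeight` is a block monomial times `N^{−kε₀}`** — the count of
`OffDiagCoreLevelsTruncCount.abs_coreTailS_block_le` verbatim (same majorant): for `‖W‖ ≤ 1`,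
`G ⊆ [N, 2N] ∩ [40, ∞)`, `0 < Δ′ ≤ 2`, `0 ≤ ε₀ ≤ 1`, `k ≥ 2`.
[cite: KowalskiMichelVanderKam2000, Lemma 3.3 p. 9, §6 p. 19 — derivation] -/
theorem abs_coreTailW_block_le {W : ℕ → ℕ → ℕ → ℕ → ℕ → ℕ → ℕ × ℕ → ℤ → ℤ → ℂ}
    (hW : ∀ q r l m d₁ d₂ i h₁ s, ‖W q r l m d₁ d₂ i h₁ s‖ ≤ 1) (hN : 1 ≤ N) (hP : 40 ≤ 2 * N)
    (G : Finset ℕ) (hG : ∀ q ∈ G, N ≤ q ∧ q ≤ 2 * N ∧ 40 ≤ q) {Δ' : ℝ} (h0 : 0 < Δ') (h2 : Δ' ≤ 2)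
    {ε₀ : ℝ} (hε₀ : 0 ≤ ε₀) (hε₁ : ε₀ ≤ 1) {k : ℕ} (hk : 2 ≤ k) :
    |coreTailW W (tailHeight ε₀ N) G (2 * N) (coreHeight ε₀) Δ'| ≤
      (2 * (N : ℝ)) ^ 7 * (2 * (N : ℝ) * (2 * (N : ℝ) * (2 * (N : ℝ) * (2 * (N : ℝ) * (121 * (2 * (N : ℝ)) ^ 2 *
        (25 * (2 * (N : ℝ)) ^ 15 * (2 * (N : ℝ) *
          (4 * π * (2 ^ (k + 1) * (9 * (∑ j ∈ Finset.range (k + 1), (k.choose j : ℝ) * (2 ^ j * dyadicBumpBound j) *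
            ((((k - j : ℕ) : ℝ) + 1) ^ 2 * (k - j) ! * ((k - j : ℕ) : ℝ) ^ (k - j))) * (2 * (N : ℝ)) ^ 10) *
          (134 * (2 * (N : ℝ)) ^ 30) * (((N : ℝ) ^ ε₀) ^ k)⁻¹))))))))) := by
  have hS0 := sobolevSum_nonneg k
  set B : ℝ := 25 * (2 * (N : ℝ)) ^ 15 * (2 * (N : ℝ) *
    (4 * π * (2 ^ (k + 1) * (9 * (∑ j ∈ Finset.range (k + 1), (k.choose j : ℝ) * (2 ^ j * dyadicBumpBound j) *
      ((((k - j : ℕ) : ℝ) + 1) ^ 2 * (k - j) ! * ((k - j : ℕ) : ℝ) ^ (k - j))) * (2 * (N : ℝ)) ^ 10) *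
    (134 * (2 * (N : ℝ)) ^ 30) * (((N : ℝ) ^ ε₀) ^ k)⁻¹))) with hB
  have hB0 : 0 ≤ B := by positivity
  have hN1 : (1 : ℝ) ≤ N := by exact_mod_cast hN
  have hG2 : ∀ q ∈ G, 2 ≤ q := fun q hq ↦ le_trans (by norm_num) (hG q hq).2.2
  refine (abs_coreTailW_le hW (tailHeight ε₀ N) G hG2 (coreHeight ε₀) Δ').trans ?_
  have hL : (⌊qhat (2 * N) ^ Δ'⌋₊ : ℝ) ≤ 2 * (N : ℝ) := by
    have := floor_qhat_rpow_le_self hP h0 h2; exact_mod_cast this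
  have hcardL : ((Finset.Icc 1 ⌊qhat (2 * N) ^ Δ'⌋₊).card : ℝ) ≤ 2 * (N : ℝ) := by
    rw [Nat.card_Icc]; simpa using hL
  have hcardR : ((Finset.range ((2 * N) ^ 7)).card : ℝ) ≤ (2 * (N : ℝ)) ^ 7 := by
    rw [Finset.card_range]; push_cast; exact le_rfl
  have hdiv : ∀ l ∈ Finset.Icc 1 ⌊qhat (2 * N) ^ Δ'⌋₊, ((l.divisors).card : ℝ) ≤ 2 * (N : ℝ) := by
    intro l hl
    have h1 : (l.divisors.card : ℝ) ≤ l := by exact_mod_cast Nat.card_divisors_le_self l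
    have h2 : (l : ℝ) ≤ ⌊qhat (2 * N) ^ Δ'⌋₊ := by exact_mod_cast (Finset.mem_Icc.mp hl).2
    linarith
  refine sum_le_card_bound_mul (by positivity) (fun r hr ↦ ?_) hcardR
  refine sum_le_card_bound_mul (by positivity) (fun l hl ↦ ?_) hcardL
  refine sum_le_card_bound_mul (by positivity) (fun m hm ↦ ?_) hcardL
  refine sum_le_card_bound_mul (by positivity) (fun d₁ hd₁ ↦ ?_) (hdiv l hl)
  refine sum_le_card_bound_mul (by positivity) (fun d₂ hd₂ ↦ ?_) (hdiv m hm)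
  have hd₁1 := Nat.pos_of_mem_divisors hd₁
  have hd₂1 := Nat.pos_of_mem_divisors hd₂
  have hnb : ((nearBoxes (2 * N) d₁ d₂ (Real.log ((2 * N : ℕ) : ℝ) ^ 4)).card : ℝ) ≤ 121 * (2 * (N : ℝ)) ^ 2 :=
    (card_nearBoxes_scales_le (q := 2 * N) hP (Nat.mul_pos hd₁1 hd₂1)).trans (log_sq_le_block N)
  refine sum_le_card_bound_mul hB0 (fun i hi ↦ ?_) hnb
  by_cases hcop : Nat.Coprime (l / d₁) (r + 1)
  swap
  · rw [if_neg hcop]; exact hB0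
  rw [if_pos hcop, hB]
  exact tail_cell_le hN hP hG h0 h2 hε₀ hε₁ hr hl hm hd₁ hd₂ hi hk

/-- **W (D5a‴): the window tail of the level-innermost block core is FUNDED.** For `0 < ε₀ ≤ 1`: for every `Δ′ ∈ (1,2)`
and `ε > 0` there is `N₀` such that for all `N ≥ N₀` and EVERY weight `‖W‖ ≤ 1`,
`|coreTailW W (tailHeight ε₀ N) (goodPrimes Δ′ N) (2N) (coreHeight ε₀) Δ′| ≤ ε·Σ_{q ∈ goodPrimes Δ′ N} ms(q)`.
[cite: KowalskiMichelVanderKam2000, Lemma 3.3 p. 9, §6 p. 19 — derivation] -/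
theorem coreTailW_funded {ε₀ : ℝ} (hε₀ : 0 < ε₀) (hε₁ : ε₀ ≤ 1) :
    ∀ Δ' : ℝ, 1 < Δ' → Δ' < 2 → ∀ ε : ℝ, 0 < ε → ∃ N₀ : ℕ, ∀ N : ℕ, N₀ ≤ N →
      ∀ W : ℕ → ℕ → ℕ → ℕ → ℕ → ℕ → ℕ × ℕ → ℤ → ℤ → ℂ, (∀ q r l m d₁ d₂ i h₁ s, ‖W q r l m d₁ d₂ i h₁ s‖ ≤ 1) →
        |coreTailW W (tailHeight ε₀ N) (goodPrimes Δ' N) (2 * N) (coreHeight ε₀) Δ'| ≤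
          ε * ∑ q ∈ goodPrimes Δ' N, mainScaleReal Δ' q := by
  set k : ℕ := ⌈71 / ε₀⌉₊ + 2 with hk
  have hk2 : 2 ≤ k := by omega
  have hkε : 71 ≤ (k : ℝ) * ε₀ := by
    have h1 : (71 / ε₀ : ℝ) ≤ ⌈71 / ε₀⌉₊ := Nat.le_ceil _
    have h2 : (k : ℝ) = (⌈71 / ε₀⌉₊ : ℝ) + 2 := by rw [hk]; push_cast; ring
    rw [h2]
    have h3 : 71 = 71 / ε₀ * ε₀ := by field_simp
    nlinarith
  set S : ℝ := ∑ j ∈ Finset.range (k + 1), (k.choose j : ℝ) * (2 ^ j * dyadicBumpBound j) *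
    ((((k - j : ℕ) : ℝ) + 1) ^ 2 * (k - j) ! * ((k - j : ℕ) : ℝ) ^ (k - j)) with hS
  have hS0 : 0 ≤ S := sobolevSum_nonneg k
  set K : ℝ := 121 * 25 * (4 * π) * 2 ^ (k + 1) * 9 * 134 * S with hK
  have hK0 : 0 ≤ K := by positivity
  have hfund := funded_of_rpow_log_saving (fun _ N ↦ K * 2 ^ 69 * (N : ℝ) ^ 69 * (((N : ℝ) ^ ε₀) ^ k)⁻¹)
    (fun Δ' h1 h2 ↦ by
      obtain ⟨N₁, hN₁⟩ := one_le_sum_mainScaleReal_eventually (by linarith) h2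
      refine ⟨2, two_pos, 0, K * 2 ^ 69, max N₁ 1, fun N hN ↦ ?_⟩
      have hNN₁ : N₁ ≤ N := le_trans (le_max_left _ _) hN
      have hN1 : 1 ≤ N := le_trans (le_max_right _ _) hN
      have hms := hN₁ N hNN₁
      have hmono := pow_mul_rpow_inv_le hN1 hkε
      have hr0 : 0 ≤ (N : ℝ) ^ (-(2 : ℝ)) := by positivity
      calc K * 2 ^ 69 * (N : ℝ) ^ 69 * (((N : ℝ) ^ ε₀) ^ k)⁻¹
          = K * 2 ^ 69 * ((N : ℝ) ^ 69 * (((N : ℝ) ^ ε₀) ^ k)⁻¹) := by ring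
        _ ≤ K * 2 ^ 69 * (N : ℝ) ^ (-(2 : ℝ)) := by gcongr
        _ = K * 2 ^ 69 * Real.log N ^ 0 * (N : ℝ) ^ (-(2 : ℝ)) * 1 := by rw [pow_zero]; ring
        _ ≤ K * 2 ^ 69 * Real.log N ^ 0 * (N : ℝ) ^ (-(2 : ℝ)) * ∑ q ∈ goodPrimes Δ' N, mainScaleReal Δ' q := by
            gcongr)
  intro Δ' h1 h2 ε hε
  obtain ⟨N₀, hN₀⟩ := hfund Δ' h1 h2 ε hε
  refine ⟨max N₀ 40, fun N hN W hW ↦ ?_⟩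
  have hNN₀ : N₀ ≤ N := le_trans (le_max_left _ _) hN
  have hN40 : 40 ≤ N := le_trans (le_max_right _ _) hN
  have hP : 40 ≤ 2 * N := by omega
  have hG : ∀ q ∈ goodPrimes Δ' N, N ≤ q ∧ q ≤ 2 * N ∧ 40 ≤ q := by
    intro q hq
    obtain ⟨hqN, hq2, -, -⟩ := KMV2000.mem_goodPrimes_iff.mp hq
    exact ⟨by omega, hq2, by omega⟩
  have hmain := abs_coreTailW_block_le hW (by omega) hP (goodPrimes Δ' N) hG (by linarith) h2.le hε₀.le hε₁ hk2
  rw [block_monomial_eq] at hmain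
  refine hmain.trans (le_trans (le_of_eq ?_) (hN₀ N hNN₀))
  simp only [hK]
  ring

end Block

end Summit.Parity.GeneralizedHardyLittlewood.Theorems.BeyondDiagonalBeatsQuarter.OffDiag
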